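import Summits.SmoothPoincare4.SmoothPoincare4.Theorems.CongruenceShadowsAgkCor6SufficiencyStubSeamFlowTube
import Summits.SmoothPoincare4.SmoothPoincare4.Theorems.CongruenceShadowsAgkCor6SufficiencyStubSeamFormTube

/-!
# Stub `stub_transport` of line `lp-by-sphere-system-surgery` for crux `AgkCor6Sufficiency`, part 1:
# index bookkeeping of the seams and the tube map
(item stmt-SmoothPoincare4-10894, routes CongruenceShadows / GroupTrisection; lead reshape r5, C;
registered helper stub `stub_transportTubeToolkit`)

Two ingredients of the transport of open spine neighbourhoods (Abrams–Gay–Kirby, proof of Thm. 5):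

* seam bookkeeping: the three indices `m`, `refIdx m`, `normIdx m` exhaust `Fin 3`, the seam
  `S (m+1) ∩ S (m+2)` is `S (refIdx m) ∩ S (normIdx m)`, and the opposite sector `S m` does not meet
  the seam neighbourhood `N m` of `SeamForms` (`SeamForms.not_mem_opposite`);
* the TUBE MAP `tubeMap tp' Ψa ρ u v x = tp' (Ψa (ρ x)) (u x) (v x)` between the tubes of two normal
  frames along `F`, `F'` related by `Ψa|F : F → F'` (`Ξ'⁻¹ ∘ (ψ × id) ∘ Ξ`): it preserves the
  normal coordinates, intertwines the retractions, is inverted by the tube map of an inverse of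
  `Ψa` on `F`, is smooth where `Ψa ∘ ρ` is, carries sectors to sectors (same wedges) and
  intertwines presentations of unit form.

References: Abrams–Gay–Kirby, Geom. Topol. 22 (2018), proof of Thm. 5 [AbramsGayKirby2018];
Gay–Kirby, Geom. Topol. 20 (2016), Def. 1 [GayKirby2016].
-/

noncomputable section

set_option linter.dupNamespace false

namespace Summit.SmoothPoincare4.SmoothPoincare4.Cruxes.AgkCor6Sufficiency.LpBySphereSystemSurgery

open Set Function
open scoped _root_.Manifold _root_.ContDiff _root_.Topology
open Literature.Topology.FourManifolds

/-! ## Seam index bookkeeping -/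

section Indices

/-- Every index is the seam index, its reference index or its normalised index. -/
theorem eq_or_eq_refIdx_or_eq_normIdx (m m₁ : Fin 3) : m₁ = m ∨ m₁ = refIdx m ∨ m₁ = normIdx m := by
  fin_cases m <;> fin_cases m₁ <;> simp [refIdx, normIdx]

/-- The seam index differs from the reference index. -/
theorem ne_refIdx (m : Fin 3) : m ≠ refIdx m := by
  fin_cases m <;> simp [refIdx]

/-- The seam index differs from the normalised index. -/
theorem ne_normIdx (m : Fin 3) : m ≠ normIdx m := by
  fin_cases m <;> simp [normIdx]

variable {X : Type} (S : Fin 3 → Set X)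

/-- The seam `S (m+1) ∩ S (m+2)` is the intersection of the reference and normalised sectors. -/
theorem seam_eq_ref_inter_norm (m : Fin 3) : S (m + 1) ∩ S (m + 2) = S (refIdx m) ∩ S (normIdx m) := by
  fin_cases m
  · rfl
  · show S (1 + 1) ∩ S (1 + 2) = S 0 ∩ S 2
    rw [inter_comm]; rfl
  · rfl

/-- The opposite sector meets the reference sector in the seam of the normalised index. -/
theorem opposite_inter_ref (m : Fin 3) :
    S m ∩ S (refIdx m) = S (normIdx m + 1) ∩ S (normIdx m + 2) := by
  fin_cases m
  · rfl
  · show S 1 ∩ S 0 = S (2 + 1) ∩ S (2 + 2)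
    rw [inter_comm]; rfl
  · rfl

/-- The opposite sector meets the normalised sector in the seam of the reference index. -/
theorem opposite_inter_norm (m : Fin 3) :
    S m ∩ S (normIdx m) = S (refIdx m + 1) ∩ S (refIdx m + 2) := by
  fin_cases m
  · show S 0 ∩ S 2 = S (1 + 1) ∩ S (1 + 2)
    rw [inter_comm]; rfl
  · rfl
  · show S 2 ∩ S 1 = S (0 + 1) ∩ S (0 + 2)
    rw [inter_comm]; rfl

/-- A box of seam `m` (`p_m > r₀`, `|q_m| < r₀/2`) misses the ray of the normalised index. -/
theorem not_ray_normIdx_of_box {m : Fin 3} {a b r₀ : ℝ} (hr₀ : 0 < r₀) (hp : r₀ < pCo m a b)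
    (hq : |qCo m a b| < r₀ / 2) :
    ¬ (qCo (normIdx m) a b = 0 ∧ 0 ≤ pCo (normIdx m) a b) := by
  obtain ⟨hq1, hq2⟩ := abs_lt.1 hq
  rintro ⟨h1, h2⟩
  fin_cases m <;> simp [pCo, qCo, normIdx] at hp hq1 hq2 h1 h2 <;> linarith

/-- A box of seam `m` misses the ray of the reference index. -/
theorem not_ray_refIdx_of_box {m : Fin 3} {a b r₀ : ℝ} (hr₀ : 0 < r₀) (hp : r₀ < pCo m a b)
    (hq : |qCo m a b| < r₀ / 2) :
    ¬ (qCo (refIdx m) a b = 0 ∧ 0 ≤ pCo (refIdx m) a b) := by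
  obtain ⟨hq1, hq2⟩ := abs_lt.1 hq
  rintro ⟨h1, h2⟩
  fin_cases m <;> simp [pCo, qCo, refIdx] at hp hq1 hq2 h1 h2 <;> linarith

end Indices

/-! ## The opposite sector does not meet the seam neighbourhood -/

section Opposite

variable {X : Type} [TopologicalSpace X] [ChartedSpace (EuclideanSpace ℝ (Fin 4)) X]
  {S : Fin 3 → Set X} {u v : X → ℝ} {ρ : X → X} {U O Ot : Set X} {G : Fin 3 → X → ℝ}
  {r₀ ε₁ : ℝ} {N : Fin 3 → Set X} {c : Fin 3 → ℕ → ℕ}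

/-- **The opposite sector `S m` does not meet `N m`.**  A point of `N m` lies in the reference or
in the normalised sector (`ref_iff`, `norm_iff`); if it also lay in `S m` it would be a point of
the seam of the normalised (resp. reference) index: outside `T(2 r₀)` that seam is inside its own
`N`, disjoint from `N m`; inside, `N m` is the box of `m`, which misses both rays. -/
theorem SeamForms.not_mem_opposite (hSF : SeamForms S u v Ot G r₀ ε₁ N)
    (hT : TriNormalForm S 0 1 2 u v ρ U O c) (hOtU : Ot ⊆ U) {m : Fin 3} {x : X}
    (hx : x ∈ N m) : x ∉ S m := by
  intro hxm
  have hr₀ := hSF.r₀_pos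
  -- in the tube: `x` is in the box of `m`
  have htube : x ∈ tubeSet Ot u v (2 * r₀) →
      r₀ < pCo m (u x) (v x) ∧ |qCo m (u x) (v x)| < r₀ / 2 := fun h2 =>
    (hSF.N_tube m x (tubeSet_mono (by linarith) (by linarith) h2)).1 hx
  rcases le_total (G (refIdx m) x) 1 with hle | hge
  · -- `x ∈ S_ref`, hence in the seam of `normIdx m`
    have hxr : x ∈ S (refIdx m) := (hSF.ref_iff m x hx).2 hle
    have hseam : x ∈ S (normIdx m + 1) ∩ S (normIdx m + 2) := by
      rw [← opposite_inter_ref S m]; exact ⟨hxm, hxr⟩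
    by_cases h2 : x ∈ tubeSet Ot u v (2 * r₀)
    · obtain ⟨hp, hq⟩ := htube h2
      have hxU : x ∈ U := hOtU h2.1
      have hray := (mem_seam_iff hT (normIdx m) hxU).1 (by
        rw [← seam_eq_ref_inter_norm S (normIdx m)]; exact hseam)
      exact not_ray_normIdx_of_box hr₀ hp hq hray
    · exact Set.disjoint_left.1 (hSF.N_disjoint m (normIdx m) (ne_normIdx m)) hx
        (hSF.seam_subset_N (normIdx m) x hseam h2)
  · -- `x ∈ S_norm`, hence in the seam of `refIdx m`
    have hxn : x ∈ S (normIdx m) := (hSF.norm_iff m x hx).2 hge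
    have hseam : x ∈ S (refIdx m + 1) ∩ S (refIdx m + 2) := by
      rw [← opposite_inter_norm S m]; exact ⟨hxm, hxn⟩
    by_cases h2 : x ∈ tubeSet Ot u v (2 * r₀)
    · obtain ⟨hp, hq⟩ := htube h2
      have hxU : x ∈ U := hOtU h2.1
      have hray := (mem_seam_iff hT (refIdx m) hxU).1 (by
        rw [← seam_eq_ref_inter_norm S (refIdx m)]; exact hseam)
      exact not_ray_refIdx_of_box hr₀ hp hq hray
    · exact Set.disjoint_left.1 (hSF.N_disjoint m (refIdx m) (ne_refIdx m)) hx
        (hSF.seam_subset_N (refIdx m) x hseam h2)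

/-- On `N m`, membership in any sector is read off `σ_m` (`ref_iff`, `norm_iff`, and the opposite
sector is absent). -/
theorem SeamForms.mem_sector_iff (hSF : SeamForms S u v Ot G r₀ ε₁ N)
    (hT : TriNormalForm S 0 1 2 u v ρ U O c) (hOtU : Ot ⊆ U) {m : Fin 3} {x : X} (hx : x ∈ N m)
    (m₁ : Fin 3) :
    x ∈ S m₁ ↔ (m₁ = refIdx m ∧ G (refIdx m) x ≤ 1) ∨ (m₁ = normIdx m ∧ 1 ≤ G (refIdx m) x) := by
  rcases eq_or_eq_refIdx_or_eq_normIdx m m₁ with rfl | rfl | rfl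
  · simp only [ne_refIdx, ne_normIdx, false_and, or_self, iff_false]
    exact hSF.not_mem_opposite hT hOtU hx
  · rw [hSF.ref_iff m x hx]
    constructor
    · intro h; exact Or.inl ⟨rfl, h⟩
    · rintro (⟨-, h⟩ | ⟨h, h'⟩)
      · exact h
      · exact absurd h (by fin_cases m <;> simp [refIdx, normIdx])
  · rw [hSF.norm_iff m x hx]
    constructor
    · intro h; exact Or.inr ⟨rfl, h⟩
    · rintro (⟨h, -⟩ | ⟨-, h⟩)
      · exact absurd h (by fin_cases m <;> simp [refIdx, normIdx])
      · exact h

end Opposite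

/-! ## The tube map -/

section TubeMap

variable {X : Type} [TopologicalSpace X] [ChartedSpace (EuclideanSpace ℝ (Fin 4)) X]
  {X' : Type} [TopologicalSpace X'] [ChartedSpace (EuclideanSpace ℝ (Fin 4)) X']

/-- **The tube map** `x ↦ tp' (Ψa (ρ x)) (u x) (v x)`: the point of the tube of `X'` over
`Ψa (ρ x) ∈ F'` with the same normal coordinates as `x`. -/
def tubeMap (tp' : X' → ℝ → ℝ → X') (Ψa : X → X') (ρ : X → X) (u v : X → ℝ) (x : X) : X' :=
  tp' (Ψa (ρ x)) (u x) (v x)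

variable {S : Fin 3 → Set X} {u v : X → ℝ} {ρ : X → X} {U O Ot : Set X} {rt : ℝ}
  {tp : X → ℝ → ℝ → X} {S' : Fin 3 → Set X'} {u' v' : X' → ℝ} {ρ' : X' → X'} {U' O' Ot' : Set X'}
  {rt' : ℝ} {tp' : X' → ℝ → ℝ → X'} {Ψa : X → X'} {Ψa' : X' → X} {s : ℝ}

/-- **Values of the tube map**: for `x` in the tube `T(s)`, `s ≤ rt'`, the image lies in `Ot'`,
over `Ψa (ρ x)`, with the normal coordinates of `x`. -/
theorem tubeMap_spec (hTS : TubeStructure (S 0) (⋂ l, S l) u v ρ O Ot rt tp)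
    (hfr : NormalFrame (⋂ l, S l) u v ρ U O)
    (hTS' : TubeStructure (S' 0) (⋂ l, S' l) u' v' ρ' O' Ot' rt' tp')
    (hΨaF : ∀ x ∈ ⋂ l, S l, Ψa x ∈ ⋂ l, S' l) (hs : s ^ 2 ≤ rt' ^ 2) {x : X}
    (hx : x ∈ tubeSet Ot u v s) :
    tubeMap tp' Ψa ρ u v x ∈ Ot' ∧ ρ' (tubeMap tp' Ψa ρ u v x) = Ψa (ρ x) ∧
      u' (tubeMap tp' Ψa ρ u v x) = u x ∧ v' (tubeMap tp' Ψa ρ u v x) = v x := by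
  have hp : Ψa (ρ x) ∈ ⋂ l, S' l := hΨaF _ (hfr.ρ_mem x (hTS.subset_O hx.1))
  have hab : u x ^ 2 + v x ^ 2 < rt' ^ 2 := lt_of_lt_of_le hx.2 hs
  exact ⟨hTS'.tp_mem _ hp _ _ hab, hTS'.ρ_tp _ hp _ _ hab, hTS'.u_tp _ hp _ _ hab,
    hTS'.v_tp _ hp _ _ hab⟩

/-- The tube map carries `T(s)` into `T'(s)` (`s ≤ rt'`). -/
theorem tubeMap_mem_tubeSet (hTS : TubeStructure (S 0) (⋂ l, S l) u v ρ O Ot rt tp)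
    (hfr : NormalFrame (⋂ l, S l) u v ρ U O)
    (hTS' : TubeStructure (S' 0) (⋂ l, S' l) u' v' ρ' O' Ot' rt' tp')
    (hΨaF : ∀ x ∈ ⋂ l, S l, Ψa x ∈ ⋂ l, S' l) (hs : s ^ 2 ≤ rt' ^ 2) {x : X}
    (hx : x ∈ tubeSet Ot u v s) : tubeMap tp' Ψa ρ u v x ∈ tubeSet Ot' u' v' s := by
  obtain ⟨hO, -, hu, hv⟩ := tubeMap_spec hTS hfr hTS' hΨaF hs hx
  exact ⟨hO, by rw [hu, hv]; exact hx.2⟩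

/-- **The tube maps of `Ψa` and of an inverse `Ψa'` of `Ψa` on `F` are mutually inverse**
(injectivity of `(ρ, u, v)` on the tube: `tp_self`). -/
theorem tubeMap_tubeMap (hTS : TubeStructure (S 0) (⋂ l, S l) u v ρ O Ot rt tp)
    (hfr : NormalFrame (⋂ l, S l) u v ρ U O)
    (hTS' : TubeStructure (S' 0) (⋂ l, S' l) u' v' ρ' O' Ot' rt' tp')
    (hΨaF : ∀ x ∈ ⋂ l, S l, Ψa x ∈ ⋂ l, S' l) (hinv : ∀ x ∈ ⋂ l, S l, Ψa' (Ψa x) = x)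
    (hs : s ^ 2 ≤ rt' ^ 2) {x : X} (hx : x ∈ tubeSet Ot u v s) :
    tubeMap tp Ψa' ρ' u' v' (tubeMap tp' Ψa ρ u v x) = x := by
  obtain ⟨-, hρ, hu, hv⟩ := tubeMap_spec hTS hfr hTS' hΨaF hs hx
  unfold tubeMap at hρ hu hv ⊢
  rw [hρ, hu, hv, hinv _ (hfr.ρ_mem x (hTS.subset_O hx.1))]
  exact hTS.tp_self x hx.1

/-- **Smoothness of the tube map** on `T(s)` (`s ≤ rt'`), when `Ψa` is smooth on an open set
containing `F`. -/
theorem contMDiffOn_tubeMap [IsManifold (𝓡 4) ∞ X]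
    (hTS : TubeStructure (S 0) (⋂ l, S l) u v ρ O Ot rt tp)
    (hfr : NormalFrame (⋂ l, S l) u v ρ U O)
    (hTS' : TubeStructure (S' 0) (⋂ l, S' l) u' v' ρ' O' Ot' rt' tp')
    (hfr' : NormalFrame (⋂ l, S' l) u' v' ρ' U' O')
    (hΨaF : ∀ x ∈ ⋂ l, S l, Ψa x ∈ ⋂ l, S' l) {Uψ : Set X} (_hUψ : IsOpen Uψ)
    (hFU : (⋂ l, S l) ⊆ Uψ) (hΨas : ContMDiffOn (𝓡 4) (𝓡 4) ∞ Ψa Uψ) (hs : s ^ 2 ≤ rt' ^ 2) :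
    ContMDiffOn (𝓡 4) (𝓡 4) ∞ (tubeMap tp' Ψa ρ u v) (tubeSet Ot u v s) := by
  have hρs : ContMDiffOn (𝓡 4) (𝓡 4) ∞ (fun x => Ψa (ρ x)) (tubeSet Ot u v s) :=
    hΨas.comp hfr.contMDiff_ρ.contMDiffOn fun x hx => hFU (hfr.ρ_mem x (hTS.subset_O hx.1))
  have h := contMDiffOn_tp_comp hTS' hfr' (J := 𝓡 4) (s := tubeSet Ot u v s) hρs
    hfr.contMDiff_u.contMDiffOn hfr.contMDiff_v.contMDiffOn
    (fun x hx => hfr'.F_subset_O (hΨaF _ (hfr.ρ_mem x (hTS.subset_O hx.1))))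
    (fun x hx => lt_of_lt_of_le hx.2 hs)
  refine h.congr fun x hx => ?_
  show tp' (Ψa (ρ x)) (u x) (v x) = tp' (ρ' (Ψa (ρ x))) (u x) (v x)
  rw [hfr'.ρ_eq_self_of_mem (hΨaF _ (hfr.ρ_mem x (hTS.subset_O hx.1)))]

/-- **The tube map carries sectors to sectors** (both are the same wedges of the normal plane). -/
theorem tubeMap_mem_sector {c c' : Fin 3 → ℕ → ℕ}
    (hTS : TubeStructure (S 0) (⋂ l, S l) u v ρ O Ot rt tp)
    (hT : TriNormalForm S 0 1 2 u v ρ U O c)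
    (hTS' : TubeStructure (S' 0) (⋂ l, S' l) u' v' ρ' O' Ot' rt' tp')
    (hT' : TriNormalForm S' 0 1 2 u' v' ρ' U' O' c')
    (hΨaF : ∀ x ∈ ⋂ l, S l, Ψa x ∈ ⋂ l, S' l) (hs : s ^ 2 ≤ rt' ^ 2) {x : X}
    (hx : x ∈ tubeSet Ot u v s) {m : Fin 3} (hxm : x ∈ S m) : tubeMap tp' Ψa ρ u v x ∈ S' m := by
  obtain ⟨hO, -, hu, hv⟩ := tubeMap_spec hTS hT.frame hTS' hΨaF hs hx
  have hxU : x ∈ U := hT.frame.O_subset_U (hTS.subset_O hx.1)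
  have hyU : tubeMap tp' Ψa ρ u v x ∈ U' := hT'.frame.O_subset_U (hTS'.subset_O hO)
  rcases hT.eq_or m with rfl | rfl | rfl
  · rw [hT'.mem_i _ hyU, hu, hv]; exact (hT.mem_i _ hxU).1 hxm
  · rw [hT'.mem_j _ hyU, hu, hv]; exact (hT.mem_j _ hxU).1 hxm
  · rw [hT'.mem_l _ hyU, hu, hv]; exact (hT.mem_l _ hxU).1 hxm

/-- **The tube map intertwines presentations of unit form** on tubes where both are unit. -/
theorem tubeMap_level (hTS : TubeStructure (S 0) (⋂ l, S l) u v ρ O Ot rt tp)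
    (hfr : NormalFrame (⋂ l, S l) u v ρ U O)
    (hTS' : TubeStructure (S' 0) (⋂ l, S' l) u' v' ρ' O' Ot' rt' tp')
    (hΨaF : ∀ x ∈ ⋂ l, S l, Ψa x ∈ ⋂ l, S' l) (hs : s ^ 2 ≤ rt' ^ 2)
    {G : Fin 3 → X → ℝ} {G' : Fin 3 → X' → ℝ} {T₀ : Set X} {T₀' : Set X'}
    (hG : ∀ m, ∀ x ∈ T₀, G m x = unitForm m (u x) (v x))
    (hG' : ∀ m, ∀ x ∈ T₀', G' m x = unitForm m (u' x) (v' x))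
    (hT₀ : tubeSet Ot u v s ⊆ T₀) (hT₀' : tubeSet Ot' u' v' s ⊆ T₀') {x : X}
    (hx : x ∈ tubeSet Ot u v s) (m : Fin 3) : G' m (tubeMap tp' Ψa ρ u v x) = G m x := by
  obtain ⟨-, -, hu, hv⟩ := tubeMap_spec hTS hfr hTS' hΨaF hs hx
  rw [hG' m _ (hT₀' (tubeMap_mem_tubeSet hTS hfr hTS' hΨaF hs hx)), hG m _ (hT₀ hx), hu, hv]

end TubeMap

/-! ## The registered helper stub -/

/-- **Toolkit of part 1** (registered helper stub `stub_transportTubeToolkit`, proved here):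
seam index bookkeeping and the two box/ray exclusions. -/
def TransportTubeToolkit : Prop :=
  (∀ m m₁ : Fin 3, m₁ = m ∨ m₁ = refIdx m ∨ m₁ = normIdx m) ∧
  (∀ m : Fin 3, m ≠ refIdx m ∧ m ≠ normIdx m) ∧
  (∀ (m : Fin 3) (a b r₀ : ℝ), 0 < r₀ → r₀ < pCo m a b → |qCo m a b| < r₀ / 2 →
    ¬ (qCo (normIdx m) a b = 0 ∧ 0 ≤ pCo (normIdx m) a b) ∧
    ¬ (qCo (refIdx m) a b = 0 ∧ 0 ≤ pCo (refIdx m) a b))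

/-- **Registered helper stub `stub_transportTubeToolkit`.** -/
theorem stub_transportTubeToolkit : TransportTubeToolkit :=
  ⟨eq_or_eq_refIdx_or_eq_normIdx, fun m => ⟨ne_refIdx m, ne_normIdx m⟩,
    fun _ _ _ _ hr hp hq => ⟨not_ray_normIdx_of_box hr hp hq, not_ray_refIdx_of_box hr hp hq⟩⟩

end Summit.SmoothPoincare4.SmoothPoincare4.Cruxes.AgkCor6Sufficiency.LpBySphereSystemSurgery

end
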